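import Literature.Geometry.Kaehler.ComplexTorusAlbertTypeIIILefschetzIdentitySpecialOrthogonalFactors
import HarnessLib

/-!
# Milne 1999 §2, type III, «Connected: No» made quantitative: under `S(X)(ℂ) ≃* ∏_w O_{m_w}(ℂ)` the identity
# component `Lf(X)(ℂ)` corresponds to `∏_w SO_{m_w}(ℂ)`, so `[S(X)(ℂ) : Lf(X)(ℂ)] = 2^f` — the component group of
# `S(A)` for a simple abelian variety of type III is `(ℤ/2)^f` («`O_n` consists of two components, `SO_n` is the
# identity component», Springer 2.2.2 (2), 2.2.9 (2))

Layer `Literature/Geometry/Kaehler`, namespace `Literature.Geometry.Kaehler.ComplexTorus`; lane `lit-hodgefound`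
(Track 2 foundations library), Layer A4 (Lefschetz groups), prover seat `lit-hodgefound-p17` (generation 63),
self-proposed row g63-#3, the sequel BY NAME of g63-#2 `ComplexTorusAlbertTypeIIILefschetzIdentitySpecialOrthogonalFactors`
(`exists_frame_mem_lefschetzIdentityC_iff_of_matrixUnitFamily_of_symplecticAdjoint`: in FILE 1 §4's frame,
`M ∈ S(X)(ℂ) ↔ M = P (1₂ ⊗ diag_w D_w) P⁻¹, ᵗD_w H_w D_w = H_w` and `M ∈ Lf(X)(ℂ) ↔` the same with `det D_w = 1`),
of g62-#4 `ComplexTorusAlbertTypeIIILefschetzGroupOrthogonalFactors` (orthonormal frames `ᵗQ H Q = 1`,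
`transpose_mul_mul_eq_iff_mem_orthogonalGroup`; its `S(X)(ℂ) ≃* ∏_w O_{m_w}(ℂ)` is re-derived here WITH the position of
`Lf(X)(ℂ)` under the isomorphism) and of A4-88 `ComplexTorusAlbertTypeIIIStablyDegenerate`
(`IsSimple.exists_matrixUnitsFamily_of_isAlbertTypeIII`).  THEOREMS ONLY (no definition, no instance, no notation,
no named fact; D-0026, net debt 0); CONCRETE torus level `X = E/Φ(ℤ^ι)`.

## Sources, verbatim

* J. S. Milne, *Lefschetz classes on abelian varieties*, Duke Math. J. **96** (1999) 639–675 (held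
  `paper:doi-10-1215-s0012-7094-99-09620-5`), §2, p. 650–651 (p0012): «*Simple abelian variety of type III.* […]
  Moreover `S(A)_{k^al} ≅ ∏ O(φ_{2,σ₁})` where the product is indexed by the embeddings `σ : F → k^al` of `F` into
  `k^al`»; Summary, p. 652 (p0014): «III ∣ O_{g/f} ∣ Yes ∣ No […] The group `S(A)_{/k^al}` is isomorphic to `f` copies
  of the group listed»; §4 Remark 4.9, p. 660–661 (p0022–p0023): «`Hg′(A)` is connected (Deligne 1982, p45) and
  `S(A)` is not—see the table at the end of Section 2. […] The class `c` is fixed by the identity component of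
  `S(A)` but not by `S(A)` itself».
* T. A. Springer, *Linear Algebraic Groups*, 2nd ed. (1998), §2.2.2 (2), p. 22 (p0039): «Assume that `k` has
  characteristic `≠ 2`. (a) The group `O_n` is not connected. (b) […] Show that `SO_n` is the identity component of
  `O_n`»; §2.2.9 (2), p. 24 (p0041): «(`char(k) ≠ 2`) The complement of `SO_n` in `O_n` is irreducible and generates
  `O_n`» (so `O_n`, `n ≥ 1`, has exactly the two components `SO_n`, `O_n ∖ SO_n`: `[O_n : SO_n] = 2`).
* H. Lange, *Abelian Varieties over the Complex Numbers* (2023), §7.2.4 Exercise (4): `Lf(X)` = the connected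
  component of the centraliser of `End_ℚ(X)` in `Sp(W, E)`.

## What is proved

* §1 **`index_eq_two_of_forall_mem_iff_det_eq_one`**: `[O_n(ℂ) : SO_n(ℂ)] = 2` for `n ≠ ∅` — the subgroup `det = 1` of Mathlib's
  complex orthogonal group `Matrix.orthogonalGroup n ℂ = {A ∣ ᵀA A = 1}` has index `2` (coset representative the
  symmetry `diag(−1, 1, …, 1)`; `det = ±1` on `O_n`); a `Π`-version of `Subgroup.index_pi` for dependent families.
* §2 **`exists_mulEquiv_pi_orthogonalGroup_lefschetzGroupC_mem_lefschetzIdentityC_iff`** — for a complete family of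
  `2 × 2` matrix-unit systems with symplectic-type adjoints (hypotheses of FILE 1 §4) an isomorphism
  `ψ : ∏_w O_{m_w}(ℂ) ≃* S(X)(ℂ)` (`rank (e w 0 0) = m_w`) UNDER WHICH `Lf(X)(ℂ)` IS `∏_w SO_{m_w}(ℂ)`:
  `ψ g ∈ Lf(X)(ℂ) ↔ det g_w = 1` for all `w`; hence **`relIndex_lefschetzIdentityC_lefschetzGroupC_eq_two_pow_of_matrixUnitFamily_of_symplecticAdjoint`**:
  if no system vanishes (`e w 0 0 ≠ 0`, i.e. `m_w ≥ 1`), `[S(X)(ℂ) : Lf(X)(ℂ)] = 2^{#W}`.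
* §3 the simple Albert type III front-end **`IsSimple.relIndex_lefschetzIdentityC_lefschetzGroupC_of_isAlbertTypeIII`**:
  `[S(X)(ℂ) : Lf(X)(ℂ)] = 2^{[K:ℚ]} = 2^f` (`K` the totally real centre of `End⁰(X)`) — the component group of
  Milne's «III ∣ O_{g/f} ∣ Connected: No» has order `2^f`.

Faithfulness notes. (i) Milne prints «Connected: No» and `S(A)_{k^al} ≅ ∏_σ O(φ_{2,σ₁})` (`f` factors); Springer prints
that `SO_n` is the identity component of `O_n` and that its complement is irreducible — `[O_n : SO_n] = 2` and hence
`[S(A) : S(A)⁰] = 2^f` are the immediate consequences formalised here; no source prints the number `2^f` as such.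
(ii) As everywhere in this lane the groups enter through complex points in `SL_ι(ℂ)`; `[S : Lf]` is the relative
index `Subgroup.relIndex` of subgroups of `SL_ι(ℂ)`.

## References

* [Milne1999LefschetzClasses] J. S. Milne, *Lefschetz classes on abelian varieties*, Duke Math. J. 96 (1999)
  639–675: §2 «Simple abelian variety of type III» (p. 650–651), Summary table (p. 652), Remark 4.9 (p. 660–661).
* [Springer1998] T. A. Springer, *Linear Algebraic Groups*, 2nd ed., Birkhäuser (1998), Exercises 2.2.2 (2) and
  2.2.9 (2).
* [Lange2023AbelianVarietiesComplex] H. Lange, *Abelian Varieties over the Complex Numbers* (2023), §7.2.4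
  Exercise (4).
-/

open Module Matrix NumberField
open scoped Kronecker
open Literature.RingTheory.CentralSimple (IsAlbertTypeIII)

namespace Literature.Geometry.Kaehler

namespace ComplexTorus

/-! ## §1 `[O_n(ℂ) : SO_n(ℂ)] = 2` -/

section OrthogonalIndex

/-- `Subgroup.index_pi` for a DEPENDENT family of groups: `[∏ G_k : ∏ H_k] = ∏ [G_k : H_k]`. [cite: Springer1998, Thm. 1.5.4 (products)] -/
private theorem index_pi_dep {κ : Type*} [Fintype κ] {β : κ → Type*} [∀ k, Group (β k)] (H : ∀ k, Subgroup (β k)) :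
    (Subgroup.pi Set.univ H).index = ∏ k, (H k).index := by
  simp_rw [Subgroup.index, ← Nat.card_pi]
  refine Nat.card_congr ((Quotient.congrRight (fun x y ↦ ?_)).trans (Setoid.piQuotientEquiv _).symm)
  rw [QuotientGroup.leftRel_pi]

/-- `det A = ±1` on the complex orthogonal group. [cite: Springer1998, Exercise 2.2.2 (2)(a)] -/
theorem det_eq_one_or_eq_neg_one_of_mem_orthogonalGroup_complex {n : Type*} [Fintype n] [DecidableEq n]
    {A : Matrix n n ℂ} (hA : A ∈ Matrix.orthogonalGroup n ℂ) : A.det = 1 ∨ A.det = -1 := by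
  have h := congrArg Matrix.det ((Matrix.mem_orthogonalGroup_iff' n ℂ).1 hA)
  rw [det_mul, det_transpose, det_one] at h
  have h2 : (A.det - 1) * (A.det + 1) = 0 := by linear_combination h
  rcases mul_eq_zero.1 h2 with h3 | h3
  · exact Or.inl (sub_eq_zero.1 h3)
  · exact Or.inr (eq_neg_of_add_eq_zero_left h3)

/-- **`[O_n(ℂ) : SO_n(ℂ)] = 2` (`n ≠ ∅`)**: the subgroup `det = 1` of the complex orthogonal group
`O_n(ℂ) = {A ∣ ᵀA A = 1}` (given by membership) has index `2` — «`O_n` is not connected», «the complement of `SO_n`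
in `O_n` is irreducible»: the two cosets are `det = 1` and `det = −1 ∋ diag(−1, 1, …, 1)`.
[cite: Springer1998, Exercises 2.2.2 (2)(a), (b) and 2.2.9 (2)] -/
theorem index_eq_two_of_forall_mem_iff_det_eq_one {n : Type*} [Fintype n] [DecidableEq n] [Nonempty n]
    {S : Subgroup (Matrix.orthogonalGroup n ℂ)}
    (hS : ∀ x : Matrix.orthogonalGroup n ℂ, x ∈ S ↔ (x : Matrix n n ℂ).det = 1) : S.index = 2 := by
  classical
  obtain ⟨i₀⟩ := ‹Nonempty n›
  -- the symmetry `r = diag(−1, 1, …, 1)`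
  set r : Matrix n n ℂ := Matrix.diagonal fun i ↦ if i = i₀ then (-1 : ℂ) else 1 with hr
  have hrO : r ∈ Matrix.orthogonalGroup n ℂ := by
    rw [Matrix.mem_orthogonalGroup_iff', hr, Matrix.diagonal_transpose, Matrix.diagonal_mul_diagonal,
      ← Matrix.diagonal_one]
    congr 1
    funext i
    split_ifs <;> norm_num
  have hrdet : r.det = -1 := by
    rw [hr, Matrix.det_diagonal, Finset.prod_ite_eq', if_pos (Finset.mem_univ _)]
  rw [Subgroup.index_eq_two_iff]
  refine ⟨⟨r, hrO⟩, fun b ↦ ?_⟩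
  rw [xor_def, hS, hS]
  have hmul : ((b * ⟨r, hrO⟩ : Matrix.orthogonalGroup n ℂ) : Matrix n n ℂ).det = (b : Matrix n n ℂ).det * (-1) := by
    rw [← hrdet, ← det_mul]
    rfl
  rw [hmul]
  rcases det_eq_one_or_eq_neg_one_of_mem_orthogonalGroup_complex b.2 with h | h
  · rw [h]
    exact Or.inr ⟨rfl, by norm_num⟩
  · rw [h]
    exact Or.inl ⟨by norm_num, by norm_num⟩

end OrthogonalIndex

/-! ## §2 Under `S(X)(ℂ) ≃* ∏_w O_{m_w}(ℂ)` the identity component `Lf(X)(ℂ)` is `∏_w SO_{m_w}(ℂ)`; the index `2^{#W}` -/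

section ComponentGroup

variable {ι : Type*} [Fintype ι] [DecidableEq ι] {E : Type*} [NormedAddCommGroup E] [NormedSpace ℂ E]
  (Φ : (ι → ℝ) ≃L[ℝ] E)

/-- **`S(X)(ℂ) ≃* ∏_w O_{m_w}(ℂ)` WITH `Lf(X)(ℂ) ↔ ∏_w SO_{m_w}(ℂ)`**: for a complete family of `2 × 2` matrix-unit systems
in `End_ℚ(X) ⊗ ℂ` with symplectic-type adjoints (hypotheses of FILE 1 §4) there is an isomorphism
`ψ : ∏_w O_{m_w}(ℂ) ≃* S(X)(ℂ)` — `(g_w)_w ↦ P (1₂ ⊗ diag_w Q_w g_w Q_w⁻¹) P⁻¹` for orthonormal frames `ᵗQ_w H_w Q_w = 1`,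
`rank (e w 0 0) = m_w`, `Σ_w 2 m_w = #ι` — under which Lange's `Lf(X)(ℂ) = S(X)(ℂ)⁰` is exactly `∏_w SO_{m_w}(ℂ)`:
**`ψ g ∈ Lf(X)(ℂ) ↔ det g_w = 1` for every `w`** («`SO_n` is the identity component of `O_n`», factor by factor).
[cite: Milne1999LefschetzClasses, §2 «Simple abelian variety of type III» (p. 650–651) and Summary table (p. 652: «III ∣ O_{g/f} ∣ Yes ∣ No»)]
[cite: Springer1998, Exercise 2.2.2 (2)(b) and Thm. 1.5.4 (ii)] [cite: Lange2023AbelianVarietiesComplex, §7.2.4 Exercise (4)] -/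
theorem exists_mulEquiv_pi_orthogonalGroup_lefschetzGroupC_mem_lefschetzIdentityC_iff {W : Type*} [Fintype W]
    [DecidableEq W] {G : Matrix ι ι ℚ} (hGt : Gᵀ = -G) (hGu : IsUnit G.det) {e : W → Fin 2 → Fin 2 → Matrix ι ι ℂ}
    (hmul : ∀ (w w' : W) (a b c d : Fin 2), e w a b * e w' c d = if w = w' ∧ b = c then e w a d else 0)
    (hone : ∑ w, (e w 0 0 + e w 1 1) = 1)
    (hspan : ∀ w a b,
      e w a b ∈ Submodule.span ℂ ((fun A : Matrix ι ι ℚ ↦ A.map (algebraMap ℚ ℂ)) '' (endAlgRat Φ : Set (Matrix ι ι ℚ))))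
    (habs : ∀ A ∈ endAlgRat Φ,
      A.map (algebraMap ℚ ℂ) ∈ Submodule.span ℂ (Set.range fun p : W × Fin 2 × Fin 2 ↦ e p.1 p.2.1 p.2.2))
    (hadj₀₀ : ∀ w, rosati (G.map (algebraMap ℚ ℂ)) (e w 0 0) = e w 1 1)
    (hadj₁₀ : ∀ w, rosati (G.map (algebraMap ℚ ℂ)) (e w 1 0) = -e w 1 0) :
    ∃ (m : W → ℕ) (ψ : ((w : W) → Matrix.orthogonalGroup (Fin (m w)) ℂ) ≃* lefschetzGroupC Φ G),
      ∑ w, 2 * m w = Fintype.card ι ∧ (∀ w, (e w 0 0).rank = m w) ∧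
      ∀ g : (w : W) → Matrix.orthogonalGroup (Fin (m w)) ℂ,
        ((ψ g : Matrix.SpecialLinearGroup ι ℂ) ∈ lefschetzIdentityC Φ G ↔
          ∀ w, ((g w : Matrix.orthogonalGroup (Fin (m w)) ℂ) : Matrix (Fin (m w)) (Fin (m w)) ℂ).det = 1) := by
  classical
  obtain ⟨m, eι, P, Hb, hP, hHbt, hHbu, hframe, hmem, hmemL⟩ :=
    exists_frame_mem_lefschetzIdentityC_iff_of_matrixUnitFamily_of_symplecticAdjoint Φ hGt hGu hmul hone hspan habs
      hadj₀₀ hadj₁₀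
  have hQ : ∀ w, ∃ Q : Matrix (Fin (m w)) (Fin (m w)) ℂ, IsUnit Q.det ∧ Qᵀ * Hb w * Q = 1 := fun w ↦
    exists_transpose_mul_mul_eq_one_of_transpose_eq_self (hHbt w) (hHbu w)
  choose Q hQu hQ1 using hQ
  -- injectivity of the frame: `P (1₂ ⊗ diag_w D_w) P⁻¹` determines `D`
  have hinjD : ∀ D D' : ∀ w, Matrix (Fin (m w)) (Fin (m w)) ℂ,
      P * ((1 : Matrix (Fin 2) (Fin 2) ℂ) ⊗ₖ Matrix.blockDiagonal' D).submatrix eι.symm eι.symm * P⁻¹ =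
        P * ((1 : Matrix (Fin 2) (Fin 2) ℂ) ⊗ₖ Matrix.blockDiagonal' D').submatrix eι.symm eι.symm * P⁻¹ → D = D' := by
    intro D D' h1
    have h2 : ((1 : Matrix (Fin 2) (Fin 2) ℂ) ⊗ₖ Matrix.blockDiagonal' D).submatrix eι.symm eι.symm =
        ((1 : Matrix (Fin 2) (Fin 2) ℂ) ⊗ₖ Matrix.blockDiagonal' D').submatrix eι.symm eι.symm := by
      have h3 := congrArg (fun X : Matrix ι ι ℂ ↦ P⁻¹ * X * P) h1
      simp only [Matrix.mul_assoc, Matrix.nonsing_inv_mul_cancel_left _ _ hP, Matrix.nonsing_inv_mul _ hP,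
        Matrix.mul_one] at h3
      exact h3
    have h4 : (1 : Matrix (Fin 2) (Fin 2) ℂ) ⊗ₖ Matrix.blockDiagonal' D =
        (1 : Matrix (Fin 2) (Fin 2) ℂ) ⊗ₖ Matrix.blockDiagonal' D' := by
      have h5 := congrArg (fun X : Matrix ι ι ℂ ↦ X.submatrix eι eι) h2
      simpa only [Matrix.submatrix_submatrix, Equiv.symm_comp_self, Matrix.submatrix_id_id] using h5
    exact Matrix.blockDiagonal'_injective (one_kronecker_injective 2 0 h4)
  -- the blocks `Dm g w = Q_w g_w Q_w⁻¹`, their block sum, and the matrix `F g = P (1₂ ⊗ diag_w Dm g w) P⁻¹`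
  let Dm : ((w : W) → Matrix.orthogonalGroup (Fin (m w)) ℂ) → ∀ w, Matrix (Fin (m w)) (Fin (m w)) ℂ := fun g w ↦
    Q w * (g w : Matrix (Fin (m w)) (Fin (m w)) ℂ) * (Q w)⁻¹
  have hDm : ∀ (g : (w : W) → Matrix.orthogonalGroup (Fin (m w)) ℂ) w,
      Dm g w = Q w * (g w : Matrix (Fin (m w)) (Fin (m w)) ℂ) * (Q w)⁻¹ := fun g w ↦ rfl
  have hDm_mul : ∀ g h : (w : W) → Matrix.orthogonalGroup (Fin (m w)) ℂ, Dm (g * h) = fun w ↦ Dm g w * Dm h w := by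
    intro g h
    funext w
    rw [hDm, hDm, hDm, Pi.mul_apply,
      show ((g w * h w : Matrix.orthogonalGroup (Fin (m w)) ℂ) : Matrix (Fin (m w)) (Fin (m w)) ℂ) =
        (g w : Matrix (Fin (m w)) (Fin (m w)) ℂ) * (h w : Matrix (Fin (m w)) (Fin (m w)) ℂ) from rfl]
    simp only [Matrix.mul_assoc]
    rw [Matrix.nonsing_inv_mul_cancel_left _ _ (hQu w)]
  have hDm_one : Dm 1 = 1 := by
    funext w
    change Q w * ((1 : Matrix.orthogonalGroup (Fin (m w)) ℂ) : Matrix (Fin (m w)) (Fin (m w)) ℂ) * (Q w)⁻¹ = 1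
    rw [show ((1 : Matrix.orthogonalGroup (Fin (m w)) ℂ) : Matrix (Fin (m w)) (Fin (m w)) ℂ) = 1 from rfl,
      Matrix.mul_one, Matrix.mul_nonsing_inv _ (hQu w)]
  have hDm_mem : ∀ (g : (w : W) → Matrix.orthogonalGroup (Fin (m w)) ℂ) w, (Dm g w)ᵀ * Hb w * Dm g w = Hb w := by
    intro g w
    rw [transpose_mul_mul_eq_iff_mem_orthogonalGroup (hQu w) (hQ1 w), hDm]
    simp only [Matrix.mul_assoc, Matrix.nonsing_inv_mul_cancel_left _ _ (hQu w), Matrix.nonsing_inv_mul _ (hQu w),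
      Matrix.mul_one]
    exact (g w).2
  have hDm_det : ∀ (g : (w : W) → Matrix.orthogonalGroup (Fin (m w)) ℂ) w,
      (Dm g w).det = ((g w : Matrix.orthogonalGroup (Fin (m w)) ℂ) : Matrix (Fin (m w)) (Fin (m w)) ℂ).det :=
    fun g w ↦ by rw [hDm, Matrix.det_conj ((Matrix.isUnit_iff_isUnit_det _).2 (hQu w))]
  let Y : ((w : W) → Matrix.orthogonalGroup (Fin (m w)) ℂ) → Matrix (Fin 2 × Σ w, Fin (m w)) (Fin 2 × Σ w, Fin (m w)) ℂ :=
    fun g ↦ (1 : Matrix (Fin 2) (Fin 2) ℂ) ⊗ₖ Matrix.blockDiagonal' (Dm g)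
  have hY : ∀ g, Y g = (1 : Matrix (Fin 2) (Fin 2) ℂ) ⊗ₖ Matrix.blockDiagonal' (Dm g) := fun g ↦ rfl
  have hY_mul : ∀ g h : (w : W) → Matrix.orthogonalGroup (Fin (m w)) ℂ, Y (g * h) = Y g * Y h := by
    intro g h
    rw [hY, hY, hY, hDm_mul, Matrix.blockDiagonal'_mul, one_kronecker_mul_one_kronecker]
  have hY_one : Y 1 = 1 := by
    rw [hY, hDm_one, Matrix.blockDiagonal'_one, Matrix.one_kronecker_one]
  let F : ((w : W) → Matrix.orthogonalGroup (Fin (m w)) ℂ) → Matrix ι ι ℂ := fun g ↦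
    P * (Y g).submatrix eι.symm eι.symm * P⁻¹
  have hF : ∀ g, F g = P * (Y g).submatrix eι.symm eι.symm * P⁻¹ := fun g ↦ rfl
  have hF_mul : ∀ g h : (w : W) → Matrix.orthogonalGroup (Fin (m w)) ℂ, F (g * h) = F g * F h := by
    intro g h
    rw [hF, hF, hF, hY_mul, ← Matrix.submatrix_mul_equiv _ _ eι.symm eι.symm eι.symm]
    simp only [Matrix.mul_assoc]
    rw [Matrix.nonsing_inv_mul_cancel_left _ _ hP]
  have hF_one : F 1 = 1 := by
    rw [hF, hY_one, Matrix.submatrix_one_equiv, Matrix.mul_one, Matrix.mul_nonsing_inv _ hP]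
  -- determinants: `(det g_w)² = 1`, `det (1₂ ⊗ diag) = (∏ det)²`
  have hdet_sq : ∀ (g : (w : W) → Matrix.orthogonalGroup (Fin (m w)) ℂ) w, (Dm g w).det ^ 2 = 1 := by
    intro g w
    have h1 := congrArg Matrix.det ((Matrix.mem_orthogonalGroup_iff' (Fin (m w)) ℂ).1 (g w).2)
    rw [Matrix.det_mul, Matrix.det_transpose, Matrix.det_one] at h1
    rw [hDm_det, pow_two]
    exact h1
  have hF_det : ∀ g : (w : W) → Matrix.orthogonalGroup (Fin (m w)) ℂ, (F g).det = 1 := by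
    intro g
    rw [hF, Matrix.det_conj ((Matrix.isUnit_iff_isUnit_det _).2 hP), Matrix.det_submatrix_equiv_self, hY,
      det_one_kronecker, det_blockDiagonal'_eq_prod, ← Finset.prod_pow]
    exact Finset.prod_eq_one fun w _ ↦ hdet_sq g w
  -- the monomorphism `θ : ∏_w O_{m_w}(ℂ) → SL_ι(ℂ)` and its image `S(X)(ℂ)`
  let θ : ((w : W) → Matrix.orthogonalGroup (Fin (m w)) ℂ) →* Matrix.SpecialLinearGroup ι ℂ :=
    { toFun := fun g ↦ ⟨F g, hF_det g⟩
      map_one' := Subtype.ext hF_one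
      map_mul' := fun g h ↦ Subtype.ext (hF_mul g h) }
  have hθ : ∀ g : (w : W) → Matrix.orthogonalGroup (Fin (m w)) ℂ,
      ((θ g : Matrix.SpecialLinearGroup ι ℂ) : Matrix ι ι ℂ) = F g := fun g ↦ rfl
  have hθinj : Function.Injective θ := by
    intro g h hgh
    have h1 : F g = F h := by rw [← hθ, ← hθ, hgh]
    rw [hF, hF, hY, hY] at h1
    have h6 : Dm g = Dm h := hinjD _ _ h1
    funext w
    apply Subtype.ext
    have h7 := congrFun h6 w
    rw [hDm, hDm] at h7
    have h8 := congrArg (fun X : Matrix (Fin (m w)) (Fin (m w)) ℂ ↦ (Q w)⁻¹ * X * Q w) h7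
    simpa only [Matrix.mul_assoc, Matrix.nonsing_inv_mul_cancel_left _ _ (hQu w), Matrix.nonsing_inv_mul _ (hQu w),
      Matrix.mul_one] using h8
  have hθmem : ∀ g : (w : W) → Matrix.orthogonalGroup (Fin (m w)) ℂ, θ g ∈ lefschetzGroupC Φ G := by
    intro g
    refine (hmem _).2 ⟨Dm g, fun w ↦ hDm_mem g w, ?_⟩
    rw [hθ, hF, hY]
  have hθsurj : ∀ M ∈ lefschetzGroupC Φ G, ∃ g : (w : W) → Matrix.orthogonalGroup (Fin (m w)) ℂ, θ g = M := by
    intro M hM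
    obtain ⟨D, hD, hMeq⟩ := (hmem M).1 hM
    have hg : ∀ w, (Q w)⁻¹ * D w * Q w ∈ Matrix.orthogonalGroup (Fin (m w)) ℂ := fun w ↦
      (transpose_mul_mul_eq_iff_mem_orthogonalGroup (hQu w) (hQ1 w) (D w)).1 (hD w)
    refine ⟨fun w ↦ ⟨(Q w)⁻¹ * D w * Q w, hg w⟩, Subtype.ext ?_⟩
    rw [hθ, hF, hY, hMeq]
    have hDD : Dm (fun w ↦ ⟨(Q w)⁻¹ * D w * Q w, hg w⟩) = D := by
      funext w
      change Q w * ((Q w)⁻¹ * D w * Q w) * (Q w)⁻¹ = D w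
      simp only [Matrix.mul_assoc]
      rw [Matrix.mul_nonsing_inv_cancel_left _ _ (hQu w), Matrix.mul_nonsing_inv _ (hQu w), Matrix.mul_one]
    rw [hDD]
  -- the position of `Lf(X)(ℂ)`: `θ g ∈ Lf ↔ det g_w = 1` for all `w`
  have hθL : ∀ g : (w : W) → Matrix.orthogonalGroup (Fin (m w)) ℂ, θ g ∈ lefschetzIdentityC Φ G ↔
      ∀ w, ((g w : Matrix.orthogonalGroup (Fin (m w)) ℂ) : Matrix (Fin (m w)) (Fin (m w)) ℂ).det = 1 := by
    intro g
    rw [hmemL]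
    constructor
    · rintro ⟨D, hD, hFD⟩
      rw [hθ, hF, hY] at hFD
      have hDmD : Dm g = D := hinjD _ _ hFD
      intro w
      rw [← hDm_det, hDmD]
      exact (hD w).2
    · intro hg
      exact ⟨Dm g, fun w ↦ ⟨hDm_mem g w, by rw [hDm_det]; exact hg w⟩, by rw [hθ, hF, hY]⟩
  -- `∏_w O_{m_w}(ℂ) ≃* S(X)(ℂ)` by restriction of the codomain
  let θ' := θ.codRestrict (lefschetzGroupC Φ G) hθmem
  have hbij : Function.Bijective θ' := by
    refine ⟨fun a b hab ↦ hθinj (congrArg Subtype.val hab), fun M ↦ ?_⟩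
    obtain ⟨g, hg⟩ := hθsurj M.1 M.2
    exact ⟨g, Subtype.ext hg⟩
  refine ⟨m, MulEquiv.ofBijective θ' hbij, ?_,
    fun w ↦ rank_eq_of_mul_eq_mul_single_kronecker_submatrix eι hP w 0 (hframe w 0 0), fun g ↦ hθL g⟩
  rw [← Fintype.card_congr eι, Fintype.card_prod, Fintype.card_fin, Fintype.card_sigma, Finset.mul_sum]
  exact Finset.sum_congr rfl fun w _ ↦ by rw [Fintype.card_fin]

omit [Fintype ι] [DecidableEq ι] in
/-- A non-zero complex matrix has non-zero rank. [folklore] -/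
private theorem rank_ne_zero_of_ne_zero {k : Type*} [Fintype k] (A : Matrix ι k ℂ) (hA : A ≠ 0) : A.rank ≠ 0 := by
  classical
  intro h
  apply hA
  rw [Matrix.rank, Submodule.finrank_eq_zero, LinearMap.range_eq_bot] at h
  ext i j
  have h2 := congrFun (LinearMap.congr_fun h (Pi.single j 1)) i
  simp only [Matrix.mulVecLin_apply, LinearMap.zero_apply, Pi.zero_apply, Matrix.mulVec, dotProduct_single,
    mul_one] at h2
  rw [h2, Matrix.zero_apply]

/-- **`[S(X)(ℂ) : Lf(X)(ℂ)] = 2^{#W}`**: for a complete family of NON-VANISHING `2 × 2` matrix-unit systems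
(`e w 0 0 ≠ 0`) in `End_ℚ(X) ⊗ ℂ` with symplectic-type adjoints, Lange's identity component `Lf(X)(ℂ) = S(X)(ℂ)⁰` has
index `2^{#W}` in `S(X)(ℂ)` — under `S(X)(ℂ) ≃* ∏_w O_{m_w}(ℂ)` it is `∏_w SO_{m_w}(ℂ)` (§2) and `[O_m : SO_m] = 2`
for `m ≥ 1` (§1); the component group of Milne's non-connected `∏_σ O(φ_{2,σ₁})` is `(ℤ/2)^{#W}`.
[cite: Milne1999LefschetzClasses, §2 Summary table (p. 652: «III ∣ O_{g/f} ∣ Connected: No») and Remark 4.9 (p. 660–661)]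
[cite: Springer1998, Exercises 2.2.2 (2) and 2.2.9 (2)] [cite: Lange2023AbelianVarietiesComplex, §7.2.4 Exercise (4)] -/
theorem relIndex_lefschetzIdentityC_lefschetzGroupC_eq_two_pow_of_matrixUnitFamily_of_symplecticAdjoint {W : Type*}
    [Fintype W] [DecidableEq W] {G : Matrix ι ι ℚ} (hGt : Gᵀ = -G) (hGu : IsUnit G.det)
    {e : W → Fin 2 → Fin 2 → Matrix ι ι ℂ}
    (hmul : ∀ (w w' : W) (a b c d : Fin 2), e w a b * e w' c d = if w = w' ∧ b = c then e w a d else 0)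
    (hone : ∑ w, (e w 0 0 + e w 1 1) = 1)
    (hspan : ∀ w a b,
      e w a b ∈ Submodule.span ℂ ((fun A : Matrix ι ι ℚ ↦ A.map (algebraMap ℚ ℂ)) '' (endAlgRat Φ : Set (Matrix ι ι ℚ))))
    (habs : ∀ A ∈ endAlgRat Φ,
      A.map (algebraMap ℚ ℂ) ∈ Submodule.span ℂ (Set.range fun p : W × Fin 2 × Fin 2 ↦ e p.1 p.2.1 p.2.2))
    (hadj₀₀ : ∀ w, rosati (G.map (algebraMap ℚ ℂ)) (e w 0 0) = e w 1 1)
    (hadj₁₀ : ∀ w, rosati (G.map (algebraMap ℚ ℂ)) (e w 1 0) = -e w 1 0) (hne : ∀ w, e w 0 0 ≠ 0) :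
    (lefschetzIdentityC Φ G).relIndex (lefschetzGroupC Φ G) = 2 ^ Fintype.card W := by
  classical
  obtain ⟨m, ψ, -, hrank, hψL⟩ :=
    exists_mulEquiv_pi_orthogonalGroup_lefschetzGroupC_mem_lefschetzIdentityC_iff Φ hGt hGu hmul hone hspan habs
      hadj₀₀ hadj₁₀
  -- non-empty blocks: `m_w = rank (e w 0 0) ≠ 0`
  have hmpos : ∀ w, Nonempty (Fin (m w)) := fun w ↦
    ⟨⟨0, Nat.pos_of_ne_zero (by rw [← hrank w]; exact rank_ne_zero_of_ne_zero (e w 0 0) (hne w))⟩⟩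
  -- the subgroup `∏_w SO` of `∏_w O` by membership, and its index (the `Π`-instance is supplied by hand: instance
  -- search does not unfold `Matrix.orthogonalGroup (Fin (m w)) ℂ` under the binder `w`)
  letI hGrp : ∀ w, Group (Matrix.orthogonalGroup (Fin (m w)) ℂ) := fun w ↦ inferInstance
  obtain ⟨SOk, hSOk⟩ : ∃ SOk : ∀ w, Subgroup (Matrix.orthogonalGroup (Fin (m w)) ℂ),
      ∀ w (x : Matrix.orthogonalGroup (Fin (m w)) ℂ), x ∈ SOk w ↔ (x : Matrix (Fin (m w)) (Fin (m w)) ℂ).det = 1 :=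
    by
    refine ⟨fun w ↦ ((Matrix.detMonoidHom : Matrix (Fin (m w)) (Fin (m w)) ℂ →* ℂ).comp
      (Matrix.orthogonalGroup (Fin (m w)) ℂ).subtype).ker, fun w x ↦ ?_⟩
    rw [MonoidHom.mem_ker]
    rfl
  have hfac : ∀ w, (SOk w).index = 2 := fun w ↦ by
    haveI := hmpos w
    exact index_eq_two_of_forall_mem_iff_det_eq_one (hSOk w)
  -- transport along `ψ`
  have hcomap : ((lefschetzIdentityC Φ G).subgroupOf (lefschetzGroupC Φ G)).comap ψ.toMonoidHom =
      Subgroup.pi Set.univ SOk := by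
    ext g
    rw [Subgroup.mem_comap, Subgroup.mem_subgroupOf, Subgroup.mem_pi]
    change ((ψ g : lefschetzGroupC Φ G) : Matrix.SpecialLinearGroup ι ℂ) ∈ lefschetzIdentityC Φ G ↔ _
    rw [hψL g]
    simp only [Set.mem_univ, true_implies, hSOk]
  have hidx : ((lefschetzIdentityC Φ G).subgroupOf (lefschetzGroupC Φ G)).index = (Subgroup.pi Set.univ SOk).index := by
    rw [← hcomap]
    exact (((lefschetzIdentityC Φ G).subgroupOf (lefschetzGroupC Φ G)).index_comap_of_surjective
      (f := ψ.toMonoidHom) ψ.surjective).symm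
  rw [Subgroup.relIndex, hidx, index_pi_dep]
  simp_rw [hfac]
  rw [Finset.prod_const, Finset.card_univ]

end ComponentGroup

/-! ## §3 Simple abelian varieties of Albert type III: the component group has order `2^f` -/

section TypeThree

variable {κ : Type} [Fintype κ] [DecidableEq κ] [Nonempty κ] {E : Type} [NormedAddCommGroup E] [NormedSpace ℂ E]
  {Ψ : (κ → ℝ) ≃L[ℝ] E} {η : E [⋀^Fin 2]→L[ℝ] ℝ} {G : Matrix κ κ ℚ}

/-- **`[S(X)(ℂ) : Lf(X)(ℂ)] = 2^f` FOR A SIMPLE POLARISED COMPLEX TORUS OF ALBERT TYPE III** (`f = [K:ℚ]`, `K` the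
totally real centre of `End⁰(X)`): Milne's «III ∣ O_{g/f} ∣ Connected: No» — `S(A)_{k^al} ≅ ∏_σ O(φ_{2,σ₁})` over the
`f` embeddings `σ` — has the component group of order `2^f`, Lange's `Lf(X) = S(X)⁰` being `∏_σ SO(φ_{2,σ₁})` («`SO_n` is
the identity component of `O_n`», `[O_n : SO_n] = 2`); the unit family is A4-88's
`IsSimple.exists_matrixUnitsFamily_of_isAlbertTypeIII` (no factor vanishes, `n = [K:ℚ]` by the centre dictionary).
[cite: Milne1999LefschetzClasses, §2 «Simple abelian variety of type III» (p. 650–651), Summary table (p. 652: «III ∣ O_{g/f} ∣ Yes ∣ No», «`f` copies») and Remark 4.9 (p. 660–661)]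
[cite: Springer1998, Exercises 2.2.2 (2) and 2.2.9 (2)]
[cite: Lange2023AbelianVarietiesComplex, §2.6.1 proof of the Proposition (type III) and §7.2.4 Exercise (4)] -/
theorem IsSimple.relIndex_lefschetzIdentityC_lefschetzGroupC_of_isAlbertTypeIII (hX : IsSimple Ψ)
    (hη : IsRiemannForm Ψ η) (hG : G.map (Rat.cast : ℚ → ℝ) = latticeGram Ψ η)
    (h : IsAlbertTypeIII (centerField Ψ hX) (endAlgRat Ψ) (rosatiEnd Ψ hη.1 hη.2.2 hG)) :
    (lefschetzIdentityC Ψ G).relIndex (lefschetzGroupC Ψ G) = 2 ^ finrank ℚ (centerField Ψ hX) := by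
  classical
  obtain ⟨n, e, -, hdiag, hoff, hspan, hone, -, hεspan, hadj, hne⟩ :=
    hX.exists_matrixUnitsFamily_of_isAlbertTypeIII hη hG h
  have hmul : ∀ (w w' : Fin n) (a b c d : Fin 2),
      e w a b * e w' c d = if w = w' ∧ b = c then e w a d else 0 := by
    intro w w' a b c d
    by_cases hw : w = w'
    · subst hw
      rw [hdiag]
      by_cases hbc : b = c
      · rw [if_pos hbc, if_pos ⟨rfl, hbc⟩]
      · rw [if_neg hbc, if_neg fun H ↦ hbc H.2]
    · rw [hoff w w' hw, if_neg fun H ↦ hw H.1]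
  have habs : ∀ A ∈ endAlgRat Ψ, A.map (algebraMap ℚ ℂ) ∈
      Submodule.span ℂ (Set.range fun p : Fin n × Fin 2 × Fin 2 ↦ e p.1 p.2.1 p.2.2) := by
    intro A hA
    have hAsum : A.map (algebraMap ℚ ℂ) = ∑ w, (e w 0 0 + e w 1 1) * A.map (algebraMap ℚ ℂ) := by
      rw [← Finset.sum_mul, hone, Matrix.one_mul]
    rw [hAsum]
    refine Submodule.sum_mem _ fun w _ ↦ Submodule.span_mono ?_ (hεspan w A hA)
    rintro _ ⟨q, rfl⟩
    exact ⟨(w, q), rfl⟩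
  -- `dim_ℚ End_ℚ(X) = 4 [K:ℚ]`, so the centre dictionary applies: `n = [K:ℚ]`
  haveI : IsScalarTower ℚ (centerField Ψ hX) (endAlgRat Ψ) := IsScalarTower.of_algebraMap_smul fun q x ↦ by
    rw [Algebra.smul_def, Algebra.algebraMap_eq_smul_one q,
      map_rat_smul (algebraMap (centerField Ψ hX) (endAlgRat Ψ)) q 1, map_one, smul_mul_assoc, one_mul]
  have hdim : finrank ℚ (endAlgRat Ψ) ≤ 4 * finrank ℚ (centerField Ψ hX) := le_of_eq <| by
    rw [← Module.finrank_mul_finrank ℚ (centerField Ψ hX) (endAlgRat Ψ), h.finrank_eq_four, mul_comm]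
  obtain ⟨hWn, -⟩ := exists_equiv_embeddings_of_matrixUnitFamily_of_central_of_finrank_le Ψ
    (centerField.valAlgHom Ψ hX) (fun k ↦ centerField.val_mem Ψ hX k) (fun k A hA ↦ centerField.val_comm Ψ hX k hA)
    hdim hne hmul hone hspan habs
  rw [relIndex_lefschetzIdentityC_lefschetzGroupC_eq_two_pow_of_matrixUnitFamily_of_symplecticAdjoint Ψ
    (transpose_eq_neg_of_map_ratCast Ψ hG) (isUnit_det_of_map_ratCast hG (isUnit_det_latticeGram Ψ hη.1 hη.2.2))
    hmul hone hspan habs (fun w ↦ (hadj w).1) (fun w ↦ (hadj w).2.2) hne, hWn]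

end TypeThree

end ComplexTorus

end Literature.Geometry.Kaehler
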